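import Mathlib
import Summits.ResolutionOfSingularities.ResolutionOfSingularities.Theorems.WeightedInvariantLocalWeightedDropPolyDescentDefs
import Summits.ResolutionOfSingularities.ResolutionOfSingularities.Theorems.WeightedInvariantLocalWeightedDropMonicDescentChartSubst
import Summits.ResolutionOfSingularities.ResolutionOfSingularities.Theorems.WeightedInvariantLocalWeightedDropMonicDescentTailTools
import Summits.ResolutionOfSingularities.ResolutionOfSingularities.Theorems.WeightedInvariantLocalWeightedDropWildMonicShiftOrder

/-!
# `WeightedInvariant.LocalWeightedDrop`, stub S3ρ: the monic polyhedron descent — the moves of Σ**_d commute with re-centring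
# (piece ρ-T, part 3a: shift algebra; CJS LNM 2270 §8 / Lemma 13.6, bookkeeping only)

Crux item stmt-ResolutionOfSingularities-8899 `LocalWeightedDrop` (route `ResolutionOfSingularities/WeightedInvariant`), registered skeleton v30
(09f812eb3be8b7d8), stub S3ρ `stub_wildMonicSurfaceReductionWon`.  [OURS · L1 W4.3, chain w43, lead prover (gen 3); a LINE UNDER THE STUB: the
monic polyhedron descent (memo `L/res-L1-w43-lead-1/g3/S3RHO-CJS-MEMO.md`, line file `poly_descent_line_v1.lean` evidence on stmt-8899), MODEL
Cossart–Jannsen–Saito LNM 2270 Ch. 8/11–13 for `J = (y^d + Σ_{j<d} A_j y^j)`, `e = 2`, `k` a field; nothing here is a statement of any manuscript.]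

Pure algebra of the three label moves against the re-centring `y ↦ y + ψ` (`WildMonic.shift`), used by the tail bookkeeping of the no-chain theorem
(part 3b) to compare the prepared labels `Â(m)`, `Â(m+1)` of consecutive steps:
* `blowOne_mul`, `blowOne_add`, `blowOne_C_mul`, `blowOne_zero`, `blowOne_finset_sum`, `blowOne_pow` — the `u₁`-chart substitution `MonicDescent.blowOne`
  is a ring map up to the bookkeeping of budgets (`blowOne (a+b) (F·G) = blowOne a F · blowOne b G` when the exponents allow);
* `blowOneT_shift` — `blowOneT (shift A ψ) = shift (blowOneT A) (blowOne 1 ψ)` for `ψ` without constant term;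
* `shear_natCast`, `shearT_shift` — the `u₂`-shear is a ring map: `shearT h (shift A ψ) = shift (shearT h A) (shear h ψ)`;
* `divOne_X_pow_mul`, `divOneT_shift` — the curve blow-up of `V(y,u₁)` against re-centring by a multiple `u₁·H`;
* `X_dvd_of_isPermissibleOneT_shift` — if both `S` and `shift S ψ` are `V(y,u₁)`-permissible (slot `j` divisible by `u₁^{d-j}`) and `0 < d`, then `u₁ ∣ ψ`
  (kill `u₁`: the image of `ψ` is nilpotent in the domain `k[[u₂]]`-slice, hence zero).
-/

set_option linter.dupNamespace false -- mandated namespace of this single-conjunct summit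

noncomputable section


namespace Summit.ResolutionOfSingularities.ResolutionOfSingularities.Theorems

namespace PolyDescent

open MvPowerSeries MonicDescent WildMonic Literature.RingTheory.TwoVariableSeries Literature.AlgebraicGeometry.Resolution

variable {k : Type} [Field k]

/-! ## `blowOne` is multiplicative with added budgets; linear; compatible with powers -/

/-- Exponent bound of a product: if all exponents of `F` have `e₀+e₁ ≥ a` and those of `G` have `≥ b`, those of `F·G` have `≥ a + b`. -/
theorem le_sum_of_mul {F G : MvPowerSeries (Fin 2) k} {a b : ℕ} (hF : ∀ e : Fin 2 →₀ ℕ, coeff e F ≠ 0 → a ≤ e 0 + e 1)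
    (hG : ∀ e : Fin 2 →₀ ℕ, coeff e G ≠ 0 → b ≤ e 0 + e 1) : ∀ e : Fin 2 →₀ ℕ, coeff e (F * G) ≠ 0 → a + b ≤ e 0 + e 1 := by
  intro e he
  rw [coeff_mul] at he
  obtain ⟨⟨f, g⟩, hfg, hne⟩ := Finset.exists_ne_zero_of_sum_ne_zero he
  replace hfg : f + g = e := Finset.HasAntidiagonal.mem_antidiagonal.mp hfg
  have hf : coeff f F ≠ 0 := fun h => hne (by rw [h, zero_mul])
  have hg : coeff g G ≠ 0 := fun h => hne (by rw [h, mul_zero])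
  have := hF f hf; have := hG g hg
  rw [← hfg, Finsupp.add_apply, Finsupp.add_apply]
  omega

/-- `blowOne (a + b) (F · G) = blowOne a F · blowOne b G` (exponent sums `≥ a` resp. `≥ b`). -/
theorem blowOne_mul {F G : MvPowerSeries (Fin 2) k} {a b : ℕ} (hF : ∀ e : Fin 2 →₀ ℕ, coeff e F ≠ 0 → a ≤ e 0 + e 1)
    (hG : ∀ e : Fin 2 →₀ ℕ, coeff e G ≠ 0 → b ≤ e 0 + e 1) : blowOne (a + b) (F * G) = blowOne a F * blowOne b G := by
  apply X_pow_mul_left_cancel (c := a + b)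
  have hs : HasSubst ![(X 0 : MvPowerSeries (Fin 2) k), X 0 * X 1] := hasSubst_of_constantCoeff_zero constantCoeff_blowFamily
  rw [X_pow_mul_blowOne (a + b) (F * G) (le_sum_of_mul hF hG), subst_mul hs, ← X_pow_mul_blowOne a F hF, ← X_pow_mul_blowOne b G hG]
  ring

/-- `blowOne` is additive. -/
theorem blowOne_add (c : ℕ) (F G : MvPowerSeries (Fin 2) k) : blowOne c (F + G) = blowOne c F + blowOne c G := by
  ext d; rw [map_add, coeff_blowOne, coeff_blowOne, coeff_blowOne]; split_ifs <;> simp [map_add]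

/-- `blowOne` commutes with scalars. -/
theorem blowOne_C_mul (c : ℕ) (x : k) (F : MvPowerSeries (Fin 2) k) : blowOne c (C x * F) = C x * blowOne c F := by
  ext d; rw [coeff_blowOne, coeff_C_mul, coeff_C_mul, coeff_blowOne]; split_ifs <;> simp

/-- `blowOne` of zero. -/
theorem blowOne_zero (c : ℕ) : blowOne c (0 : MvPowerSeries (Fin 2) k) = 0 := by
  ext d; rw [coeff_blowOne]; split_ifs <;> simp

/-- `blowOne` on a finite sum. -/
theorem blowOne_finset_sum {ι : Type*} (s : Finset ι) (c : ℕ) (F : ι → MvPowerSeries (Fin 2) k) :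
    blowOne c (∑ i ∈ s, F i) = ∑ i ∈ s, blowOne c (F i) := by
  classical
  induction s using Finset.induction_on with
  | empty => rw [Finset.sum_empty, Finset.sum_empty, blowOne_zero]
  | insert i s hi ih => rw [Finset.sum_insert hi, Finset.sum_insert hi, blowOne_add, ih]

/-- Exponent bounds of a power. -/
theorem le_sum_of_pow {G : MvPowerSeries (Fin 2) k} {b : ℕ} (hG : ∀ e : Fin 2 →₀ ℕ, coeff e G ≠ 0 → b ≤ e 0 + e 1) (n : ℕ) :
    ∀ e : Fin 2 →₀ ℕ, coeff e (G ^ n) ≠ 0 → n * b ≤ e 0 + e 1 := by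
  induction n with
  | zero => intro e _; simp
  | succ n ih =>
    intro e he
    rw [pow_succ] at he
    have := le_sum_of_mul ih hG e he
    rw [Nat.succ_mul]; exact this

/-- `blowOne (n·b) (G^n) = (blowOne b G)^n`. -/
theorem blowOne_pow {G : MvPowerSeries (Fin 2) k} {b : ℕ} (hG : ∀ e : Fin 2 →₀ ℕ, coeff e G ≠ 0 → b ≤ e 0 + e 1) (n : ℕ) :
    blowOne (n * b) (G ^ n) = blowOne b G ^ n := by
  induction n with
  | zero =>
    rw [zero_mul, pow_zero, pow_zero]
    ext d
    rw [coeff_blowOne]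
    simp only [add_zero]
    by_cases h : d 1 ≤ d 0
    · rw [if_pos h, coeff_one, coeff_one]
      by_cases hd : d = 0
      · subst hd; simp
      · rw [if_neg, if_neg hd]
        intro heq
        apply hd
        have h0 := congrArg (fun P => P 0) heq
        have h1 := congrArg (fun P => P 1) heq
        simp only [Finsupp.add_apply, Finsupp.single_apply] at h0 h1
        simp at h0 h1
        exact finsupp_fin2_ext (by simp; omega) (by simp; omega)
    · rw [if_neg h, coeff_one, if_neg]
      rintro rfl
      simp at h
  | succ n ih =>
    rw [Nat.succ_mul, pow_succ, pow_succ, blowOne_mul (le_sum_of_pow hG n) hG, ih]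

/-! ## The `u₁`-chart commutes with re-centring: `blowOneT (shift A g) = shift (blowOneT A) (blowOne 1 g)` -/

/-- THE `u₁`-CHART OF A RE-CENTRED TUPLE (weak position `ord A_j ≥ d − j`, `g(0) = 0`): slotwise
`blowOne (d−i) (shift A g)_i = (shift (blowOneT A) (blowOne 1 g))_i` (degree-2 instance `MonicDescent.blowOne_recentre`). -/
theorem blowOneT_shift {d : ℕ} (A : Fin d → MvPowerSeries (Fin 2) k) (g : MvPowerSeries (Fin 2) k)
    (hA : ∀ j : Fin d, ((d - (j : ℕ) : ℕ) : ℕ∞) ≤ (A j).order) (hg : (1 : ℕ∞) ≤ g.order) :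
    blowOneT d (shift d A g) = shift d (blowOneT d A) (blowOne 1 g) := by
  funext i
  have hgs : ∀ e : Fin 2 →₀ ℕ, coeff e g ≠ 0 → 1 ≤ e 0 + e 1 := le_sum_of_le_order hg
  show blowOne (d - (i : ℕ)) (shift d A g i) = shift d (blowOneT d A) (blowOne 1 g) i
  rw [shift_eq, shift_eq, blowOne_add, blowOne_finset_sum]
  congr 1
  · rw [show ((d.choose (i : ℕ) : ℕ) : MvPowerSeries (Fin 2) k) = C ((d.choose (i : ℕ) : ℕ) : k) by rw [map_natCast],
      blowOne_C_mul, ← blowOne_pow hgs, Nat.mul_one]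
  · refine Finset.sum_congr rfl fun j _ => ?_
    by_cases hji : (i : ℕ) ≤ (j : ℕ)
    · have hsplit : d - (i : ℕ) = (d - (j : ℕ)) + ((j : ℕ) - i) * 1 := by have := j.2; omega
      rw [show (((j : ℕ).choose (i : ℕ) : ℕ) : MvPowerSeries (Fin 2) k) = C ((((j : ℕ).choose (i : ℕ)) : ℕ) : k) by rw [map_natCast],
        mul_assoc, mul_assoc, blowOne_C_mul, hsplit, blowOne_mul (le_sum_of_le_order (hA j)) (le_sum_of_pow hgs _), blowOne_pow hgs]
      rfl
    · rw [Nat.choose_eq_zero_of_lt (by omega), Nat.cast_zero, zero_mul, zero_mul, zero_mul, zero_mul, blowOne_zero]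

/-! ## The `u₂`-shear commutes with re-centring -/

/-- The shear of a natural-number scalar. -/
theorem shear_natCast (h : MvPowerSeries (Fin 2) k) (n : ℕ) : shear h (n : MvPowerSeries (Fin 2) k) = n := by
  rw [shear_eq, ← coe_substAlgHom (hasSubst_of_constantCoeff_zero (constantCoeff_shearFamily h)), map_natCast]

/-- THE SHEAR OF A RE-CENTRED TUPLE: `shear h ((shift A g)_i) = (shift (shearT h A) (shear h g))_i` (the shear is a ring map). -/
theorem shearT_shift {d : ℕ} (h : MvPowerSeries (Fin 2) k) (A : Fin d → MvPowerSeries (Fin 2) k) (g : MvPowerSeries (Fin 2) k) :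
    shearT h (shift d A g) = shift d (shearT h A) (shear h g) := by
  funext i
  show shear h (shift d A g i) = shift d (shearT h A) (shear h g) i
  have hs := hasSubst_of_constantCoeff_zero (constantCoeff_shearFamily h)
  have hφ : ∀ F : MvPowerSeries (Fin 2) k, shear h F = substAlgHom hs F := fun F => by rw [shear_eq, coe_substAlgHom]
  have hT : ∀ j : Fin d, shearT h A j = substAlgHom hs (A j) := fun j => hφ (A j)
  rw [shift_eq, shift_eq, hφ, hφ, map_add, map_mul, map_natCast, map_pow, map_sum]
  simp only [map_mul, map_natCast, map_pow, hT]

/-! ## The curve blow-up `V(y,u₁)` commutes with re-centring by a multiple of `u₁` -/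

/-- `divOne c (u₁^c · H) = H`. -/
theorem divOne_X_pow_mul (c : ℕ) (H : MvPowerSeries (Fin 2) k) : divOne c (X 0 ^ c * H) = H := by
  ext d
  rw [coeff_divOne, X_pow_eq, coeff_monomial_mul, if_pos (by intro i; fin_cases i <;> simp), one_mul]
  have hidx : (d + Finsupp.single 0 c - Finsupp.single 0 c : Fin 2 →₀ ℕ) = d := finsupp_fin2_ext (by simp) (by simp)
  rw [hidx]

/-- THE CURVE CHART OF A RE-CENTRED TUPLE: if `u₁^{d−j} ∣ A_j` for all `j` then `divOneT (shift A (u₁·g)) = shift (divOneT A) g`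
(degree-2 instance `MonicDescent.divOne_recentre`). -/
theorem divOneT_shift {d : ℕ} (A : Fin d → MvPowerSeries (Fin 2) k) (g : MvPowerSeries (Fin 2) k) (hA : IsPermissibleOneT d A) :
    divOneT d (shift d A (X 0 * g)) = shift d (divOneT d A) g := by
  funext i
  show divOne (d - (i : ℕ)) (shift d A (X 0 * g) i) = shift d (divOneT d A) g i
  have hfac : ∀ j : Fin d, A j = X 0 ^ (d - (j : ℕ)) * divOne (d - (j : ℕ)) (A j) := fun j => (X_pow_mul_divOne _ _ (hA j)).symm
  have hsum : shift d A (X 0 * g) i = X 0 ^ (d - (i : ℕ)) * shift d (divOneT d A) g i := by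
    rw [shift_eq, shift_eq, mul_add, Finset.mul_sum]
    congr 1
    · rw [mul_pow, ← mul_assoc, mul_comm (X 0 ^ _), mul_assoc]
      ring
    · refine Finset.sum_congr rfl fun j _ => ?_
      by_cases hji : (i : ℕ) ≤ (j : ℕ)
      · conv_lhs => rw [hfac j]
        have hsplit : d - (i : ℕ) = (d - (j : ℕ)) + ((j : ℕ) - i) := by have := j.2; omega
        rw [mul_pow, hsplit, pow_add]
        show _ = X 0 ^ (d - (j : ℕ)) * X 0 ^ ((j : ℕ) - i) * (((((j : ℕ).choose (i : ℕ)) : ℕ) : MvPowerSeries (Fin 2) k) *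
          divOneT d A j * g ^ ((j : ℕ) - i))
        simp only [divOneT]
        ring
      · rw [Nat.choose_eq_zero_of_lt (by omega), Nat.cast_zero, zero_mul, zero_mul, zero_mul, zero_mul, mul_zero]
  rw [hsum, divOne_X_pow_mul]

/-- If `S` and its re-centring `shift S ψ` are BOTH `V(y,u₁)`-permissible (`d ≥ 1`) then `u₁ ∣ ψ` (read the slot `0` modulo `u₁`: it is `ψ^d`). -/
theorem X_dvd_of_isPermissibleOneT_shift {d : ℕ} (hd : 0 < d) {S : Fin d → MvPowerSeries (Fin 2) k} {ψ : MvPowerSeries (Fin 2) k}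
    (hS : IsPermissibleOneT d S) (hS' : IsPermissibleOneT d (shift d S ψ)) : X 0 ∣ ψ := by
  classical
  -- kill `u₁`: every slot of `S` dies, slot `0` of the shift becomes `κ(ψ)^d`, and it must die too
  set κ : MvPowerSeries (Fin 2) k → MvPowerSeries (Fin 2) k := fun F => subst ![(0 : MvPowerSeries (Fin 2) k), X 1] F with hκ
  have hks : HasSubst ![(0 : MvPowerSeries (Fin 2) k), X 1] :=
    hasSubst_of_constantCoeff_zero fun i => by fin_cases i <;> simp [constantCoeff_X]
  have hkill : ∀ F : MvPowerSeries (Fin 2) k, (∀ e : Fin 2 →₀ ℕ, coeff e F ≠ 0 → 1 ≤ e 0) → κ F = 0 := by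
    intro F hF
    ext e
    show coeff e (subst ![(0 : MvPowerSeries (Fin 2) k), X 1] F) = coeff e 0
    rw [coeff_killOne, MvPowerSeries.coeff_zero]
    split_ifs with he
    · by_contra hne; have := hF e hne; omega
    · rfl
  have hdvd_iff : ∀ F : MvPowerSeries (Fin 2) k, κ F = 0 → X 0 ∣ F := by
    intro F hF
    rw [X_dvd_iff]
    intro m hm
    have h := congrArg (coeff m) hF
    change coeff m (subst ![(0 : MvPowerSeries (Fin 2) k), X 1] F) = coeff m 0 at h
    rw [coeff_killOne, if_pos hm, MvPowerSeries.coeff_zero] at h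
    exact h
  apply hdvd_iff
  -- slot 0 of the shift
  let i₀ : Fin d := ⟨0, hd⟩
  have hslot : shift d S ψ i₀ = ψ ^ d + ∑ j : Fin d, S j * ψ ^ (j : ℕ) := by
    rw [shift_eq]
    simp only [i₀, Nat.choose_zero_right, Nat.cast_one, one_mul, Nat.sub_zero]
  have hkS : ∀ j : Fin d, κ (S j) = 0 := fun j => hkill (S j) fun e he => le_trans (by have := j.2; omega) (hS j e he)
  have hkS' : κ (shift d S ψ i₀) = 0 := hkill _ fun e he => le_trans (by show 1 ≤ d - 0; omega) (hS' i₀ e he)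
  have hpow : κ ψ ^ d = 0 := by
    have h : subst ![(0 : MvPowerSeries (Fin 2) k), X 1] (shift d S ψ i₀) = 0 := hkS'
    rw [hslot, ← coe_substAlgHom hks, map_add, map_pow, map_sum] at h
    simp only [map_mul, map_pow, coe_substAlgHom] at h
    have hzero : ∑ j : Fin d, subst ![(0 : MvPowerSeries (Fin 2) k), X 1] (S j) * subst ![(0 : MvPowerSeries (Fin 2) k), X 1] ψ ^ (j : ℕ) = 0 :=
      Finset.sum_eq_zero fun j _ => by rw [show subst ![(0 : MvPowerSeries (Fin 2) k), X 1] (S j) = κ (S j) from rfl, hkS j, zero_mul]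
    rw [hzero, add_zero] at h
    exact h
  exact pow_eq_zero_iff (hd.ne') |>.mp hpow

end PolyDescent

end Summit.ResolutionOfSingularities.ResolutionOfSingularities.Theorems
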